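import Summits.FinalStateConjecture.FinalStateConjecture.Theorems.PhotonSphereChannelsUniformPhotonSphereChannelsRMajorantToolkit

/-!
# Crux `UniformPhotonSphereChannelsR` (K1R), line `crum-peeling-recessive-tower` —
# Theorem A, rung step (A3), part 2/5: the remainder sums of the q-recursion

Scaled bounds for the five remainder sums `S3 … S7` of the exact q-recursion `(Qn)` of
`stub_qFormRecursion`, under the profile hypothesis `|G i| ρ^i ≤ 2ρ/i²`, the inductive q-bound
`|q m| ρ^m ≤ 16 ρ ω(m)` (`m < n`) and the convolution inequalities (CV2)–(CV4) of
`stub_convolutionBounds`: each is `O(ρ²/n)` resp. `O(ρ² ω(n))` with an absolute constant.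
-/

set_option linter.dupNamespace false

noncomputable section

namespace Summit.FinalStateConjecture.FinalStateConjecture.Theorems.CrumPeelingRecessiveTower

open Finset

/-! ### The remainder sums `S3 … S7` of the q-recursion (scaled bounds)

Throughout: `λ ≥ 2` real, `0 ≤ ρ ≤ 2⁻¹⁴`, the weight `ω(m) = 1/(m(2λ−1+m))`, the profile hypothesis
`|G i| ρ^i ≤ 2ρ/i²` (`i ≥ 2`), the forcing bound `|α i| ρ^i ≤ 3ρ/i` (`i ≥ 1`), the shift bound
`|G 1| ρ ≤ θ ≤ 2⁻¹⁰`, and the INDUCTIVE bound `|q m| ρ^m ≤ 16ρ ω(m)` for `1 ≤ m < n`. -/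

section Remainder

variable {lam ρ θ : ℝ} {G q α : ℕ → ℝ} {n : ℕ}

/-- **S3.** `|Σ_{2≤i<n} G i (n−i) q (n−i)| ρⁿ ≤ 96 ρ²/n` (uses (CV4)). -/
theorem remainder_S3 :
    ∀ {lam ρ : ℝ} {G q : ℕ → ℝ} {n : ℕ}, 2 ≤ lam → 0 ≤ ρ → 2 ≤ n → (∀ i, 2 ≤ i → |G i| * ρ ^ i ≤ 2 *
      ρ / (i : ℝ) ^ 2) → (∀ m, 1 ≤ m → m < n → |q m| * ρ ^ m ≤ 16 * ρ * (1 / ((m : ℝ) * (2 * lam - 1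
      + m)))) → ∑ i ∈ Finset.Ico 2 n, (1 / ((i : ℝ) ^ 2)) * (1 / (2 * lam - 1 + ((n - i : ℕ) : ℝ)))
      ≤ 3 / (2 * lam - 1 + n) → |∑ i ∈ Finset.Ico 2 n, G i * ((n : ℝ) - i) * q (n - i)| * ρ ^ n ≤ 96
      * ρ ^ 2 / n := by
  intro lam ρ G q n hlam hρ hn hG hq hCV4
  have hnr : (2 : ℝ) ≤ n := by exact_mod_cast hn
  -- reorder the factors to match `majorant_sum_mul₃` with weight `c i = n - i`
  have hre : ∑ i ∈ Finset.Ico 2 n, G i * ((n : ℝ) - i) * q (n - i)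
      = ∑ i ∈ Finset.Ico 2 n, ((n : ℝ) - i) * G i * q (n - i) :=
    Finset.sum_congr rfl fun i _ => by ring
  rw [hre]
  have hmaj := majorant_sum_mul₃ (s := Finset.Ico 2 n) (n := n) (c := fun i => (n : ℝ) - i) (x := G)
    (y := q) (X := fun i => 2 * ρ / (i : ℝ) ^ 2)
    (Y := fun m => 16 * ρ * (1 / ((m : ℝ) * (2 * lam - 1 + m)))) hρ
    (fun i hi => by have := (Finset.mem_Ico.1 hi).2; omega)
    (fun i hi => hG i (Finset.mem_Ico.1 hi).1)
    (fun i hi => by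
      have h := Finset.mem_Ico.1 hi
      exact hq (n - i) (by omega) (by omega))
  refine hmaj.trans ?_
  -- evaluate the majorant: |n-i| · 2ρ/i² · 16ρ ω(n-i) = 32ρ² / (i² (2λ-1+n-i))
  have hterm : ∀ i ∈ Finset.Ico 2 n,
      |(n : ℝ) - i| * (2 * ρ / (i : ℝ) ^ 2) * (16 * ρ * (1 / ((((n - i : ℕ) : ℝ)) * (2 * lam - 1 + ((n - i : ℕ) : ℝ)))))
        = 32 * ρ ^ 2 * ((1 / ((i : ℝ) ^ 2)) * (1 / (2 * lam - 1 + ((n - i : ℕ) : ℝ)))) := by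
    intro i hi
    have h := Finset.mem_Ico.1 hi
    have hcast : (((n - i : ℕ) : ℝ)) = (n : ℝ) - i := by rw [Nat.cast_sub (by omega)]
    have hpos : 0 < (n : ℝ) - i := by
      have : (i : ℝ) + 1 ≤ n := by exact_mod_cast h.2
      linarith
    rw [hcast, abs_of_pos hpos]
    have hi0 : (0 : ℝ) < i := by have : (2:ℝ) ≤ i := by exact_mod_cast h.1
                                 linarith
    have h2 : 0 < 2 * lam - 1 + ((n : ℝ) - i) := by linarith
    field_simp
    ring
  rw [Finset.sum_congr rfl hterm, ← Finset.mul_sum]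
  have hn0 : (0 : ℝ) < n := by linarith
  calc 32 * ρ ^ 2 * ∑ i ∈ Finset.Ico 2 n, (1 / ((i : ℝ) ^ 2)) * (1 / (2 * lam - 1 + ((n - i : ℕ) : ℝ)))
      ≤ 32 * ρ ^ 2 * (3 / (2 * lam - 1 + n)) := mul_le_mul_of_nonneg_left hCV4 (by positivity)
    _ ≤ 32 * ρ ^ 2 * (3 / n) := by
        apply mul_le_mul_of_nonneg_left _ (by positivity)
        exact div_le_div_of_nonneg_left (by norm_num) hn0 (by linarith)
    _ = 96 * ρ ^ 2 / n := by ring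

/-- **S5.** `|Σ_{1≤i<n} q i q (n−i)| ρⁿ ≤ 2731 ρ² ω(n)` (uses (CV2) at `m = n` and `1 + log 2λ ≤ 2λ`). -/
theorem remainder_S5 (hlam : 2 ≤ lam) (hρ : 0 ≤ ρ) (hn : 2 ≤ n)
    (hq : ∀ m, 1 ≤ m → m < n → |q m| * ρ ^ m ≤ 16 * ρ * (1 / ((m : ℝ) * (2 * lam - 1 + m))))
    (hCV2 : ∑ i ∈ Finset.Ico 1 n, (1 / ((i : ℝ) * (2 * lam - 1 + i)))
        * (1 / ((((n - i : ℕ) : ℝ)) * (2 * lam - 1 + ((n - i : ℕ) : ℝ))))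
      ≤ (16 / 3) * (1 / ((n : ℝ) * (2 * lam - 1 + n))) * (1 + Real.log (2 * lam)) / lam) :
    |∑ i ∈ Finset.Ico 1 n, q i * q (n - i)| * ρ ^ n ≤ 2731 * ρ ^ 2 * (1 / ((n : ℝ) * (2 * lam - 1 + n))) := by
  have hmaj := majorant_sum_mul (s := Finset.Ico 1 n) (n := n) (x := q) (y := q)
    (X := fun m => 16 * ρ * (1 / ((m : ℝ) * (2 * lam - 1 + m))))
    (Y := fun m => 16 * ρ * (1 / ((m : ℝ) * (2 * lam - 1 + m)))) hρ
    (fun i hi => by have := (Finset.mem_Ico.1 hi).2; omega)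
    (fun i hi => by have h := Finset.mem_Ico.1 hi; exact hq i h.1 h.2)
    (fun i hi => by have h := Finset.mem_Ico.1 hi; exact hq (n - i) (by omega) (by omega))
  refine hmaj.trans ?_
  have hterm : ∀ i ∈ Finset.Ico 1 n,
      (16 * ρ * (1 / ((i : ℝ) * (2 * lam - 1 + i))))
        * (16 * ρ * (1 / ((((n - i : ℕ) : ℝ)) * (2 * lam - 1 + ((n - i : ℕ) : ℝ)))))
        = 256 * ρ ^ 2 * ((1 / ((i : ℝ) * (2 * lam - 1 + i)))
            * (1 / ((((n - i : ℕ) : ℝ)) * (2 * lam - 1 + ((n - i : ℕ) : ℝ))))) := by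
    intro i _; ring
  rw [Finset.sum_congr rfl hterm, ← Finset.mul_sum]
  have hlog : 1 + Real.log (2 * lam) ≤ 2 * lam := by
    have := Real.log_le_sub_one_of_pos (show 0 < 2 * lam by linarith)
    linarith
  have hω0 : 0 ≤ 1 / ((n : ℝ) * (2 * lam - 1 + n)) := (omegaW_pos hlam (by omega)).le
  have hlam0 : 0 < lam := by linarith
  calc 256 * ρ ^ 2 * ∑ i ∈ Finset.Ico 1 n, (1 / ((i : ℝ) * (2 * lam - 1 + i)))
          * (1 / ((((n - i : ℕ) : ℝ)) * (2 * lam - 1 + ((n - i : ℕ) : ℝ))))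
      ≤ 256 * ρ ^ 2 * ((16 / 3) * (1 / ((n : ℝ) * (2 * lam - 1 + n))) * (1 + Real.log (2 * lam)) / lam) :=
        mul_le_mul_of_nonneg_left hCV2 (by positivity)
    _ ≤ 256 * ρ ^ 2 * ((16 / 3) * (1 / ((n : ℝ) * (2 * lam - 1 + n))) * (2 * lam) / lam) := by
        apply mul_le_mul_of_nonneg_left _ (by positivity)
        apply div_le_div_of_nonneg_right _ hlam0.le
        exact mul_le_mul_of_nonneg_left hlog (by positivity)
    _ = (8192 / 3) * ρ ^ 2 * (1 / ((n : ℝ) * (2 * lam - 1 + n))) := by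
        field_simp
        ring
    _ ≤ 2731 * ρ ^ 2 * (1 / ((n : ℝ) * (2 * lam - 1 + n))) := by
        apply mul_le_mul_of_nonneg_right _ hω0
        nlinarith [sq_nonneg ρ]

/-- **S6.** `|Σ_{1≤i<n} α i q (n−i)| ρⁿ ≤ 192 ρ²/n` (uses (CV3)). -/
theorem remainder_S6 (_hlam : 2 ≤ lam) (hρ : 0 ≤ ρ) (hn : 2 ≤ n)
    (hαb : ∀ i, 1 ≤ i → |α i| * ρ ^ i ≤ 3 * ρ / i)
    (hq : ∀ m, 1 ≤ m → m < n → |q m| * ρ ^ m ≤ 16 * ρ * (1 / ((m : ℝ) * (2 * lam - 1 + m))))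
    (hCV3 : (n : ℝ) * ∑ i ∈ Finset.Ico 1 n, (1 / (i : ℝ))
        * (1 / ((((n - i : ℕ) : ℝ)) * (2 * lam - 1 + ((n - i : ℕ) : ℝ)))) ≤ 4) :
    |∑ i ∈ Finset.Ico 1 n, α i * q (n - i)| * ρ ^ n ≤ 192 * ρ ^ 2 / n := by
  have hnr : (2 : ℝ) ≤ n := by exact_mod_cast hn
  have hn0 : (0 : ℝ) < n := by linarith
  have hmaj := majorant_sum_mul (s := Finset.Ico 1 n) (n := n) (x := α) (y := q)
    (X := fun i => 3 * ρ / i)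
    (Y := fun m => 16 * ρ * (1 / ((m : ℝ) * (2 * lam - 1 + m)))) hρ
    (fun i hi => by have := (Finset.mem_Ico.1 hi).2; omega)
    (fun i hi => by have h := Finset.mem_Ico.1 hi; exact hαb i h.1)
    (fun i hi => by have h := Finset.mem_Ico.1 hi; exact hq (n - i) (by omega) (by omega))
  refine hmaj.trans ?_
  have hterm : ∀ i ∈ Finset.Ico 1 n,
      (3 * ρ / i) * (16 * ρ * (1 / ((((n - i : ℕ) : ℝ)) * (2 * lam - 1 + ((n - i : ℕ) : ℝ)))))
        = 48 * ρ ^ 2 * ((1 / (i : ℝ))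
            * (1 / ((((n - i : ℕ) : ℝ)) * (2 * lam - 1 + ((n - i : ℕ) : ℝ))))) := by
    intro i _; ring
  rw [Finset.sum_congr rfl hterm, ← Finset.mul_sum]
  have hS : ∑ i ∈ Finset.Ico 1 n, (1 / (i : ℝ))
        * (1 / ((((n - i : ℕ) : ℝ)) * (2 * lam - 1 + ((n - i : ℕ) : ℝ)))) ≤ 4 / n := by
    rw [le_div_iff₀ hn0, mul_comm]
    exact hCV3
  calc 48 * ρ ^ 2 * ∑ i ∈ Finset.Ico 1 n, (1 / (i : ℝ))
          * (1 / ((((n - i : ℕ) : ℝ)) * (2 * lam - 1 + ((n - i : ℕ) : ℝ))))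
      ≤ 48 * ρ ^ 2 * (4 / n) := mul_le_mul_of_nonneg_left hS (by positivity)
    _ = 192 * ρ ^ 2 / n := by ring

/-- **S7.** `|Σ_{1≤i<n−1} α i (Σ_{1≤j<n−i} q j q (n−i−j))| ρⁿ ≤ 3 ρ²/n`
(uses S5 at every level `2 ≤ m ≤ n−1`, (CV2) there, (CV3) at `n`, and `ρ ≤ 2⁻¹⁴`). -/
theorem remainder_S7 (hlam : 2 ≤ lam) (hρ : 0 ≤ ρ) (hρle : ρ ≤ 1 / 16384) (hn : 2 ≤ n)
    (hαb : ∀ i, 1 ≤ i → |α i| * ρ ^ i ≤ 3 * ρ / i)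
    (hq : ∀ m, 1 ≤ m → m < n → |q m| * ρ ^ m ≤ 16 * ρ * (1 / ((m : ℝ) * (2 * lam - 1 + m))))
    (hCV2 : ∀ m : ℕ, 2 ≤ m → m ≤ n → ∑ i ∈ Finset.Ico 1 m, (1 / ((i : ℝ) * (2 * lam - 1 + i)))
        * (1 / ((((m - i : ℕ) : ℝ)) * (2 * lam - 1 + ((m - i : ℕ) : ℝ))))
      ≤ (16 / 3) * (1 / ((m : ℝ) * (2 * lam - 1 + m))) * (1 + Real.log (2 * lam)) / lam)
    (hCV3 : (n : ℝ) * ∑ i ∈ Finset.Ico 1 n, (1 / (i : ℝ))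
        * (1 / ((((n - i : ℕ) : ℝ)) * (2 * lam - 1 + ((n - i : ℕ) : ℝ)))) ≤ 4) :
    |∑ i ∈ Finset.Ico 1 (n - 1), α i * ∑ j ∈ Finset.Ico 1 (n - i), q j * q (n - i - j)| * ρ ^ n
      ≤ 3 * ρ ^ 2 / n := by
  have hnr : (2 : ℝ) ≤ n := by exact_mod_cast hn
  have hn0 : (0 : ℝ) < n := by linarith
  -- inner bound at level m = n - i (2 ≤ m ≤ n-1)
  set y : ℕ → ℝ := fun m => ∑ j ∈ Finset.Ico 1 m, q j * q (m - j) with hy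
  have hinner : ∀ m, 2 ≤ m → m < n →
      |y m| * ρ ^ m ≤ 2731 * ρ ^ 2 * (1 / ((m : ℝ) * (2 * lam - 1 + m))) := by
    intro m hm2 hmn
    exact remainder_S5 (n := m) hlam hρ hm2 (fun m' h1 h2 => hq m' h1 (by omega)) (hCV2 m hm2 hmn.le)
  have hmaj := majorant_sum_mul (s := Finset.Ico 1 (n - 1)) (n := n) (x := α) (y := y)
    (X := fun i => 3 * ρ / i)
    (Y := fun m => 2731 * ρ ^ 2 * (1 / ((m : ℝ) * (2 * lam - 1 + m)))) hρ
    (fun i hi => by have := (Finset.mem_Ico.1 hi).2; omega)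
    (fun i hi => by have h := Finset.mem_Ico.1 hi; exact hαb i h.1)
    (fun i hi => by have h := Finset.mem_Ico.1 hi; exact hinner (n - i) (by omega) (by omega))
  have hre : ∑ i ∈ Finset.Ico 1 (n - 1), α i * ∑ j ∈ Finset.Ico 1 (n - i), q j * q (n - i - j)
      = ∑ i ∈ Finset.Ico 1 (n - 1), α i * y (n - i) := by
    refine Finset.sum_congr rfl fun i _ => ?_
    simp only [hy]
  rw [hre]
  refine hmaj.trans ?_
  have hterm : ∀ i ∈ Finset.Ico 1 (n - 1),
      (3 * ρ / i) * (2731 * ρ ^ 2 * (1 / ((((n - i : ℕ) : ℝ)) * (2 * lam - 1 + ((n - i : ℕ) : ℝ)))))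
        = 8193 * ρ ^ 3 * ((1 / (i : ℝ))
            * (1 / ((((n - i : ℕ) : ℝ)) * (2 * lam - 1 + ((n - i : ℕ) : ℝ))))) := by
    intro i _; ring
  rw [Finset.sum_congr rfl hterm, ← Finset.mul_sum]
  -- extend the index range to `Ico 1 n` (nonnegative terms) and use (CV3)
  have hext : ∑ i ∈ Finset.Ico 1 (n - 1), (1 / (i : ℝ))
          * (1 / ((((n - i : ℕ) : ℝ)) * (2 * lam - 1 + ((n - i : ℕ) : ℝ))))
      ≤ ∑ i ∈ Finset.Ico 1 n, (1 / (i : ℝ))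
          * (1 / ((((n - i : ℕ) : ℝ)) * (2 * lam - 1 + ((n - i : ℕ) : ℝ)))) := by
    apply Finset.sum_le_sum_of_subset_of_nonneg (Finset.Ico_subset_Ico_right (by omega))
    intro i hi _
    have h := Finset.mem_Ico.1 hi
    have h1 : (1 : ℝ) ≤ i := by exact_mod_cast h.1
    have h2 : (1 : ℝ) ≤ ((n - i : ℕ) : ℝ) := by exact_mod_cast (show 1 ≤ n - i by omega)
    have h3 : 0 < 2 * lam - 1 + ((n - i : ℕ) : ℝ) := by linarith
    positivity
  have hS : ∑ i ∈ Finset.Ico 1 n, (1 / (i : ℝ))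
        * (1 / ((((n - i : ℕ) : ℝ)) * (2 * lam - 1 + ((n - i : ℕ) : ℝ)))) ≤ 4 / n := by
    rw [le_div_iff₀ hn0, mul_comm]
    exact hCV3
  have hρ3 : ρ ^ 3 ≤ ρ ^ 2 * (1 / 16384) := by
    rw [pow_succ]
    exact mul_le_mul_of_nonneg_left hρle (by positivity)
  calc 8193 * ρ ^ 3 * ∑ i ∈ Finset.Ico 1 (n - 1), (1 / (i : ℝ))
          * (1 / ((((n - i : ℕ) : ℝ)) * (2 * lam - 1 + ((n - i : ℕ) : ℝ))))
      ≤ 8193 * ρ ^ 3 * (4 / n) := mul_le_mul_of_nonneg_left (hext.trans hS) (by positivity)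
    _ ≤ 8193 * (ρ ^ 2 * (1 / 16384)) * (4 / n) := by
        apply mul_le_mul_of_nonneg_right _ (by positivity)
        exact mul_le_mul_of_nonneg_left hρ3 (by norm_num)
    _ ≤ 3 * ρ ^ 2 / n := by
        rw [div_eq_mul_one_div (3 * ρ ^ 2), show (4 : ℝ) / n = 4 * (1 / n) by ring]
        have : 0 ≤ 1 / (n : ℝ) := by positivity
        nlinarith [sq_nonneg ρ]

/-- **S4.** `|(n−1) q (n−1) + G 1 (n−2) q (n−2) + Σ_{2≤i<n−1} G i (n−1−i) q (n−1−i)| ρⁿ ≤ 17 ρ²/n`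
(uses S3 one level down, hence (CV4) at `n−1`; `|G 1| ρ ≤ θ ≤ 2⁻¹⁰`). -/
theorem remainder_S4 (hlam : 2 ≤ lam) (hρ : 0 ≤ ρ) (hρle : ρ ≤ 1 / 16384) (hn : 2 ≤ n)
    (hθ : |G 1| * ρ ≤ θ) (hθle : θ ≤ 1 / 1024)
    (hG : ∀ i, 2 ≤ i → |G i| * ρ ^ i ≤ 2 * ρ / (i : ℝ) ^ 2)
    (hq : ∀ m, 1 ≤ m → m < n → |q m| * ρ ^ m ≤ 16 * ρ * (1 / ((m : ℝ) * (2 * lam - 1 + m))))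
    (hCV4' : 3 ≤ n → ∑ i ∈ Finset.Ico 2 (n - 1), (1 / ((i : ℝ) ^ 2))
        * (1 / (2 * lam - 1 + (((n - 1) - i : ℕ) : ℝ))) ≤ 3 / (2 * lam - 1 + ((n - 1 : ℕ) : ℝ))) :
    |((n : ℝ) - 1) * q (n - 1) + G 1 * ((n : ℝ) - 2) * q (n - 2)
        + ∑ i ∈ Finset.Ico 2 (n - 1), G i * ((n : ℝ) - 1 - i) * q (n - 1 - i)| * ρ ^ n
      ≤ 17 * ρ ^ 2 / n := by
  have hnr : (2 : ℝ) ≤ n := by exact_mod_cast hn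
  have hn0 : (0 : ℝ) < n := by linarith
  have hθ0 : 0 ≤ θ := (mul_nonneg (abs_nonneg _) hρ).trans hθ
  -- (a) the single shift
  have ha : |((n : ℝ) - 1) * q (n - 1)| * ρ ^ n ≤ 16 * ρ ^ 2 / n := by
    have h := majorant_shift_one hρ (by omega : 1 ≤ n) ((n : ℝ) - 1) (hq (n - 1) (by omega) (by omega))
    rw [abs_of_nonneg (by linarith : (0 : ℝ) ≤ (n : ℝ) - 1)] at h
    have hcast : (((n - 1 : ℕ) : ℝ)) = (n : ℝ) - 1 := by rw [Nat.cast_sub (by omega)]; norm_num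
    rw [hcast] at h
    refine h.trans ?_
    have h2 : 0 < 2 * lam - 1 + ((n : ℝ) - 1) := by linarith
    have h1 : 0 < (n : ℝ) - 1 := by linarith
    rw [show ρ * ((n : ℝ) - 1) * (16 * ρ * (1 / (((n : ℝ) - 1) * (2 * lam - 1 + ((n : ℝ) - 1)))))
        = 16 * ρ ^ 2 / (2 * lam - 1 + ((n : ℝ) - 1)) by field_simp]
    apply div_le_div_of_nonneg_left (by positivity) hn0 (by linarith)
  -- (b) the double shift (vanishes for n = 2)
  have hb : |G 1 * ((n : ℝ) - 2) * q (n - 2)| * ρ ^ n ≤ 16 * θ * ρ ^ 2 / n := by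
    rcases Nat.lt_or_ge n 3 with hlt | hge
    · obtain rfl : n = 2 := by omega
      norm_num
      positivity
    · have h := majorant_shift_two hρ hn (G 1 * ((n : ℝ) - 2)) (hq (n - 2) (by omega) (by omega))
      have hcast : (((n - 2 : ℕ) : ℝ)) = (n : ℝ) - 2 := by rw [Nat.cast_sub (by omega)]; norm_num
      rw [hcast] at h
      refine h.trans ?_
      have hn2 : (1 : ℝ) ≤ (n : ℝ) - 2 := by
        have : (3 : ℝ) ≤ n := by exact_mod_cast hge
        linarith
      have h2 : 0 < 2 * lam - 1 + ((n : ℝ) - 2) := by linarith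
      rw [abs_mul, abs_of_nonneg (by linarith : (0 : ℝ) ≤ (n : ℝ) - 2)]
      -- ρ² |G1| (n-2) · 16ρ/((n-2)(2λ-1+n-2)) = 16 ρ (|G1| ρ) · 1/(2λ-3+n)
      rw [show ρ ^ 2 * (|G 1| * ((n : ℝ) - 2)) * (16 * ρ * (1 / (((n : ℝ) - 2) * (2 * lam - 1 + ((n : ℝ) - 2)))))
          = 16 * ρ ^ 2 * (|G 1| * ρ) * (1 / (2 * lam - 1 + ((n : ℝ) - 2))) by field_simp]
      calc 16 * ρ ^ 2 * (|G 1| * ρ) * (1 / (2 * lam - 1 + ((n : ℝ) - 2)))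
          ≤ 16 * ρ ^ 2 * θ * (1 / n) := by
            apply mul_le_mul (mul_le_mul_of_nonneg_left hθ (by positivity)) _ (by positivity) (by positivity)
            exact div_le_div_of_nonneg_left zero_le_one hn0 (by linarith)
        _ = 16 * θ * ρ ^ 2 / n := by ring
  -- (c) the shifted convolution (vanishes for n = 2)
  have hc : |∑ i ∈ Finset.Ico 2 (n - 1), G i * ((n : ℝ) - 1 - i) * q (n - 1 - i)| * ρ ^ n
      ≤ 192 * ρ ^ 3 / n := by
    rcases Nat.lt_or_ge n 3 with hlt | hge
    · obtain rfl : n = 2 := by omega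
      norm_num
      positivity
    · have h3 := remainder_S3 (n := n - 1) hlam hρ (by omega) hG
        (fun m h1 h2 => hq m h1 (by omega)) (hCV4' hge)
      have hcast : (((n - 1 : ℕ) : ℝ)) = (n : ℝ) - 1 := by rw [Nat.cast_sub (by omega)]; norm_num
      rw [hcast] at h3
      have hre : ∑ i ∈ Finset.Ico 2 (n - 1), G i * ((n : ℝ) - 1 - i) * q (n - 1 - i)
          = ∑ i ∈ Finset.Ico 2 (n - 1), G i * (((n : ℝ) - 1) - i) * q (n - 1 - i) :=
        Finset.sum_congr rfl fun i _ => by ring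
      rw [hre]
      have hsplit : ρ ^ n = ρ ^ (n - 1) * ρ := by rw [← pow_succ, Nat.sub_add_cancel (by omega)]
      rw [hsplit, ← mul_assoc]
      calc |∑ i ∈ Finset.Ico 2 (n - 1), G i * (((n : ℝ) - 1) - i) * q (n - 1 - i)| * ρ ^ (n - 1) * ρ
          ≤ 96 * ρ ^ 2 / ((n : ℝ) - 1) * ρ := mul_le_mul_of_nonneg_right h3 hρ
        _ ≤ 96 * ρ ^ 2 * (2 / n) * ρ := by
            apply mul_le_mul_of_nonneg_right _ hρ
            rw [div_eq_mul_one_div]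
            apply mul_le_mul_of_nonneg_left _ (by positivity)
            rw [div_le_div_iff₀ (by linarith) hn0]
            nlinarith
        _ = 192 * ρ ^ 3 / n := by ring
  -- combine
  have htri : |((n : ℝ) - 1) * q (n - 1) + G 1 * ((n : ℝ) - 2) * q (n - 2)
        + ∑ i ∈ Finset.Ico 2 (n - 1), G i * ((n : ℝ) - 1 - i) * q (n - 1 - i)| * ρ ^ n
      ≤ |((n : ℝ) - 1) * q (n - 1)| * ρ ^ n + |G 1 * ((n : ℝ) - 2) * q (n - 2)| * ρ ^ n
        + |∑ i ∈ Finset.Ico 2 (n - 1), G i * ((n : ℝ) - 1 - i) * q (n - 1 - i)| * ρ ^ n := by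
    have h1 := abs_add_le (((n : ℝ) - 1) * q (n - 1) + G 1 * ((n : ℝ) - 2) * q (n - 2))
      (∑ i ∈ Finset.Ico 2 (n - 1), G i * ((n : ℝ) - 1 - i) * q (n - 1 - i))
    have h2 := abs_add_le (((n : ℝ) - 1) * q (n - 1)) (G 1 * ((n : ℝ) - 2) * q (n - 2))
    have hρn : 0 ≤ ρ ^ n := pow_nonneg hρ n
    nlinarith
  refine htri.trans ((add_le_add (add_le_add ha hb) hc).trans ?_)
  -- 16 + 16θ + 192ρ ≤ 17
  rw [← add_div, ← add_div, div_le_div_iff_of_pos_right hn0]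
  have hρ3 : ρ ^ 3 ≤ ρ ^ 2 * (1 / 16384) := by
    rw [pow_succ]; exact mul_le_mul_of_nonneg_left hρle (by positivity)
  nlinarith [sq_nonneg ρ, mul_nonneg hθ0 (sq_nonneg ρ)]

end Remainder

end Summit.FinalStateConjecture.FinalStateConjecture.Theorems.CrumPeelingRecessiveTower
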